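import Summits.SmoothPoincare4.SmoothPoincare4.Theorems.DottedCircleRasmussenDcrGapHelperFriendsCarrierVkPartBRayRadius
import Summits.SmoothPoincare4.SmoothPoincare4.Theorems.DottedCircleRasmussenDcrGapHelperFriendsCarrierVkPartBRayReparam

/-!
# Helper `helper_friendsCarrier_Vk_partB_disc` (piece of the registered stub
`helper_friendsCarrier_Vk_partB`, line `mk_friends`, skeleton v8) for crux `DcrGap`
(item stmt-SmoothPoincare4-16128, route route-SmoothPoincare4-DottedCircleRasmussen)

**The flow-line reparametrisation of the model slice disc (half B1 of Part B of V_k).**  For a neat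
model slice disc `f₁` of the model knot `K₁`, the neat-adapted clock field `V` and a `C^∞` flow `Φ` of
`V` fixing time `0`, there is a model slice disc `g` of `K₁` WITH THE SAME IMAGE `g(𝔻²) = f₁(𝔻²)`
which near the boundary circle is swept by the flow lines from `K₁`:

  `g(t u) = Φ(1 - t, K₁ u)`  (`1 - τ₁ ≤ t ≤ 1`),  indeed  `g x = Φ(1 - ‖x‖, f₁(x/‖x‖))`  (`‖x‖ ≥ 1 - τ₁`).

`g = f₁ ∘ R` near the closed disc for the ray reparametrisation `R` of `…VkPartBRayReparam` built on
the level-parametrised radius `ρ` of `…VkPartBRayRadius` (`R x = ρ(x) x/‖x‖` near the circle, so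
`f₁(R x) = Φ(1 - ‖x‖, f₁(x/‖x‖))` there), continued by the flow formula outside; `R` is a `C^∞`
self-bijection of `𝔻²` fixing the circle, injective with injective differential on a neighbourhood, so
`g` is again a model slice disc.  The map `R` is exported too (the framing of `f₁` is transported to `g`
through it in the tube construction).

No definitions, no named facts, no `sorry`.
-/

-- the prescribed namespace `Summit.<P>.<Sub>.…` duplicates `SmoothPoincare4` (P = Sub)
set_option linter.dupNamespace false
set_option linter.style.longLine false

noncomputable section

open scoped Manifold ContDiff Topology
open Set Function Metric Filter
open Literature.Topology.FourManifolds Literature.Topology.FourManifolds.MMSW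

namespace Summit.SmoothPoincare4.SmoothPoincare4.Theorems.DcrGap.MkFriends

namespace FriendsCarrierVk

set_option maxHeartbeats 800000 in
/-- **The flow-line reparametrisation of the model slice disc.** [folklore] -/
theorem exists_flowDisc (k : ℕ) {K₁ : (Metric.sphere (0 : EuclideanSpace ℝ (Fin 2)) 1) → (EuclideanSpace ℝ (Fin 4))} {f₁ : (EuclideanSpace ℝ (Fin 2)) → (EuclideanSpace ℝ (Fin 4))} {V : (EuclideanSpace ℝ (Fin 4)) → (EuclideanSpace ℝ (Fin 4))} {Φ : ℝ × (EuclideanSpace ℝ (Fin 4)) → (EuclideanSpace ℝ (Fin 4))} {R δ' : ℝ}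
    (hK : IsModelKnot k K₁) (hf : IsModelSliceDisc k K₁ f₁)
    (hneat : ∀ t : (Metric.sphere (0 : EuclideanSpace ℝ (Fin 2)) 1), deriv (fun ρ : ℝ => levelFun k (f₁ (ρ • (t : (EuclideanSpace ℝ (Fin 2)))))) 1 < 0)
    (hV : ContDiff ℝ ∞ V) (hVR : ∀ y, R ≤ ‖y‖ → V y = 0) (hδ' : 0 < δ')
    (htan : ∀ (u : (Metric.sphere (0 : EuclideanSpace ℝ (Fin 2)) 1)) (t : ℝ), 1 - δ' < t → t < 1 + δ' →
      V (f₁ (t • (u : (EuclideanSpace ℝ (Fin 2))))) = (fderiv ℝ (fun y => levelFun k (f₁ y)) (t • (u : (EuclideanSpace ℝ (Fin 2)))) (u : (EuclideanSpace ℝ (Fin 2))))⁻¹ • fderiv ℝ f₁ (t • (u : (EuclideanSpace ℝ (Fin 2)))) (u : (EuclideanSpace ℝ (Fin 2))))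
    (hΦs : ContDiff ℝ ∞ Φ) (hΦ : ∀ x s, HasDerivAt (fun s : ℝ => Φ (s, x)) (V (Φ (s, x))) s) (hΦ0 : ∀ x, Φ (0, x) = x) :
    ∃ (g : (EuclideanSpace ℝ (Fin 2)) → (EuclideanSpace ℝ (Fin 4))) (Rm : (EuclideanSpace ℝ (Fin 2)) → (EuclideanSpace ℝ (Fin 2))) (τ₁ : ℝ), 0 < τ₁ ∧ τ₁ ≤ 1 / 4 ∧
      IsModelSliceDisc k K₁ g ∧ g '' closedBall 0 1 = f₁ '' closedBall 0 1 ∧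
      (∀ x : (EuclideanSpace ℝ (Fin 2)), ‖x‖ < 1 + τ₁ → g x = f₁ (Rm x)) ∧
      (∀ x : (EuclideanSpace ℝ (Fin 2)), ‖x‖ < 1 + τ₁ → ContDiffAt ℝ ∞ Rm x) ∧
      (∀ x : (EuclideanSpace ℝ (Fin 2)), ‖x‖ < 1 + τ₁ → Injective (fderiv ℝ Rm x)) ∧
      (∀ x : (EuclideanSpace ℝ (Fin 2)), ‖x‖ ≤ 1 → ‖Rm x‖ ≤ 1) ∧ (∀ x : (EuclideanSpace ℝ (Fin 2)), ‖x‖ = 1 → Rm x = x) ∧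
      (∀ x : (EuclideanSpace ℝ (Fin 2)), 1 - τ₁ ≤ ‖x‖ → g x = Φ (1 - ‖x‖, f₁ (unitVec x))) ∧
      (∀ (u : (Metric.sphere (0 : EuclideanSpace ℝ (Fin 2)) 1)) (t : ℝ), 1 - τ₁ ≤ t → t ≤ 1 → g (t • (u : (EuclideanSpace ℝ (Fin 2)))) = Φ (1 - t, K₁ u)) := by
  have hfs : ContDiff ℝ ∞ f₁ := contMDiff_iff_contDiff.1 hf.1
  -- the radius and the reparametrisation
  obtain ⟨ρ, τ, hτ, hτh, hρ, hone⟩ := exists_rayRadius k hK hf hneat hV hVR hδ' htan hΦs hΦ hΦ0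
  obtain ⟨Rm, τ₁, hτ₁, hτ₁τ, hRs, hRband, hRcirc, hRlt, hRim, hRinj, hRimm⟩ :=
    exists_rayReparam hτ hτh (fun x hx => (hρ x hx).1) (fun x hx => (hρ x hx).2.1) (fun x hx => (hρ x hx).2.2.1) hone
  -- the disc
  classical
  set g : (EuclideanSpace ℝ (Fin 2)) → (EuclideanSpace ℝ (Fin 4)) := fun x => if ‖x‖ < 1 + τ₁ / 2 then f₁ (Rm x) else Φ (1 - ‖x‖, f₁ (unitVec x)) with hg
  have hg_in : ∀ x : (EuclideanSpace ℝ (Fin 2)), ‖x‖ < 1 + τ₁ / 2 → g x = f₁ (Rm x) := fun x hx => by simp only [hg, if_pos hx]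
  have hg_out : ∀ x : (EuclideanSpace ℝ (Fin 2)), 1 - τ₁ ≤ ‖x‖ → g x = Φ (1 - ‖x‖, f₁ (unitVec x)) := by
    intro x hx
    by_cases h : ‖x‖ < 1 + τ₁ / 2
    · rw [hg_in x h, hRband x hx (by linarith)]
      have hx0 : x ≠ 0 := by intro h0; rw [h0, norm_zero] at hx; linarith
      have hxa : |‖x‖ - 1| < τ := by rw [abs_lt]; constructor <;> linarith
      rw [mul_smul, ← unitVec_eq hx0]
      exact (hρ x hxa).2.2.2.1
    · simp only [hg, if_neg h]
  -- `R` maps the closed disc into itself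
  have hRle : ∀ x : (EuclideanSpace ℝ (Fin 2)), ‖x‖ ≤ 1 → ‖Rm x‖ ≤ 1 := by
    intro x hx
    have : Rm x ∈ Rm '' closedBall 0 1 := ⟨x, mem_closedBall_zero_iff.2 hx, rfl⟩
    rw [hRim] at this
    exact mem_closedBall_zero_iff.1 this
  -- smoothness
  have hgs : ContDiff ℝ ∞ g := by
    rw [contDiff_iff_contDiffAt]
    intro x
    by_cases h : ‖x‖ < 1 + τ₁ / 2
    · have hev : g =ᶠ[𝓝 x] fun y => f₁ (Rm y) := by
        filter_upwards [(isOpen_lt continuous_norm continuous_const).mem_nhds h] with y hy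
        exact hg_in y hy
      exact (hfs.contDiffAt.comp x (hRs x (by linarith))).congr_of_eventuallyEq hev
    · have hlt : 1 - τ₁ < ‖x‖ := by push Not at h; linarith
      have hx0 : x ≠ 0 := by intro h0; rw [h0, norm_zero] at hlt; linarith
      have hev : g =ᶠ[𝓝 x] fun y => Φ (1 - ‖y‖, f₁ (unitVec y)) := by
        filter_upwards [(isOpen_lt continuous_const continuous_norm).mem_nhds hlt] with y hy
        exact hg_out y hy.le
      refine ContDiffAt.congr_of_eventuallyEq ?_ hev
      exact hΦs.contDiffAt.comp x ((contDiffAt_const.sub (contDiffAt_norm ℝ hx0)).prodMk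
        (hfs.contDiffAt.comp x (contDiffAt_unitVec hx0)))
  -- the model slice disc clauses
  have hdisc : IsModelSliceDisc k K₁ g := by
    refine ⟨hgs.contMDiff, ?_, ?_, ?_, ?_⟩
    · -- injective on the closed disc
      intro x hx y hy hxy
      rw [mem_closedBall_zero_iff] at hx hy
      rw [hg_in x (by linarith), hg_in y (by linarith)] at hxy
      have h := hf.2.1 (mem_closedBall_zero_iff.2 (hRle x hx)) (mem_closedBall_zero_iff.2 (hRle y hy)) hxy
      exact hRinj (mem_ball_zero_iff.2 (by linarith)) (mem_ball_zero_iff.2 (by linarith)) h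
    · -- immersion on the closed disc
      intro x hx
      rw [mem_closedBall_zero_iff] at hx
      rw [mfderiv_eq_fderiv]
      have hev : g =ᶠ[𝓝 x] fun y => f₁ (Rm y) := by
        filter_upwards [(isOpen_lt continuous_norm continuous_const).mem_nhds (show ‖x‖ < 1 + τ₁ / 2 by linarith)] with y hy
        exact hg_in y hy
      rw [hev.fderiv_eq]
      have hRd : HasFDerivAt Rm (fderiv ℝ Rm x) x := ((hRs x (by linarith)).differentiableAt (by simp)).hasFDerivAt
      have hfd : HasFDerivAt f₁ (fderiv ℝ f₁ (Rm x)) (Rm x) := ((hfs.differentiable (by simp)) _).hasFDerivAt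
      have hcomp : HasFDerivAt (fun y => f₁ (Rm y)) ((fderiv ℝ f₁ (Rm x)).comp (fderiv ℝ Rm x)) x := hfd.comp x hRd
      rw [hcomp.fderiv]
      have h1 := hf.2.2.1 (Rm x) (mem_closedBall_zero_iff.2 (hRle x hx))
      rw [mfderiv_eq_fderiv] at h1
      exact h1.comp (hRimm x (by linarith))
    · -- the interior misses `D_k`
      intro x hx
      rw [hg_in x (by linarith)]
      exact hf.apply_notMem ((hRlt x (by linarith)).2 hx)
    · -- the boundary circle
      intro u
      have hu : ‖(u : (EuclideanSpace ℝ (Fin 2)))‖ = 1 := by simp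
      rw [hg_in _ (by rw [hu]; linarith), hRcirc _ hu, hf.apply_sphere u]
  refine ⟨g, Rm, τ₁ / 2, by positivity, by linarith, hdisc, ?_, fun x hx => hg_in x hx, fun x hx => hRs x (by linarith),
    fun x hx => hRimm x (by linarith), hRle, hRcirc, fun x hx => hg_out x (by linarith), fun u t ht1 ht2 => ?_⟩
  · -- the image of the closed disc
    have h1 : g '' closedBall 0 1 = f₁ '' (Rm '' closedBall 0 1) := by
      rw [image_image]
      refine image_congr fun x hx => hg_in x ?_
      linarith [mem_closedBall_zero_iff.1 hx]
    rw [h1, hRim]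
  · -- the flow lines on the band
    have ht0 : 0 < t := by linarith
    have hn : ‖t • (u : (EuclideanSpace ℝ (Fin 2)))‖ = t := norm_smul_coe_sphere ht0.le u
    rw [hg_out _ (by rw [hn]; linarith), hn, unitVec_smul_coe ht0, hf.apply_sphere u]

end FriendsCarrierVk

open FriendsCarrierVk in
/-- **Helper `helper_friendsCarrier_Vk_partB_disc`** (piece of the registered stub
`helper_friendsCarrier_Vk_partB`: the flow-line reparametrisation of the model slice disc).  For a neat
model slice disc `f₁` of a model knot `K₁`, the neat-adapted field `V` and a `C^∞` flow `Φ` of `V` fixing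
time `0`, there is a model slice disc `g = f₁ ∘ R` (near the closed disc) of `K₁` with `g(𝔻²) = f₁(𝔻²)`,
`g x = Φ(1 - ‖x‖, f₁(x/‖x‖))` for `‖x‖ ≥ 1 - τ₁` (so `g(t u) = Φ(1 - t, K₁ u)` on the band), where `R` is
`C^∞` with injective differential near the closed disc, maps `𝔻²` into itself and fixes the circle.
[folklore] -/
theorem helper_friendsCarrier_Vk_partB_disc : ∀ (k : ℕ) (K₁ : (Metric.sphere (0 : EuclideanSpace ℝ (Fin 2)) 1) → EuclideanSpace ℝ (Fin 4)) (f₁ : EuclideanSpace ℝ (Fin 2) → EuclideanSpace ℝ (Fin 4)) (V : EuclideanSpace ℝ (Fin 4) → EuclideanSpace ℝ (Fin 4)) (Φ : ℝ × EuclideanSpace ℝ (Fin 4) → EuclideanSpace ℝ (Fin 4)) (R δ' : ℝ), IsModelKnot k K₁ → IsModelSliceDisc k K₁ f₁ → (∀ t : (Metric.sphere (0 : EuclideanSpace ℝ (Fin 2)) 1), deriv (fun ρ : ℝ => levelFun k (f₁ (ρ • (t : EuclideanSpace ℝ (Fin 2))))) 1 < 0) → ContDiff ℝ ((⊤ : ℕ∞)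 : WithTop ℕ∞) V → (∀ y, R ≤ ‖y‖ → V y = 0) → 0 < δ' → (∀ (u : (Metric.sphere (0 : EuclideanSpace ℝ (Fin 2)) 1)) (t : ℝ), 1 - δ' < t → t < 1 + δ' → V (f₁ (t • (u : EuclideanSpace ℝ (Fin 2)))) = (fderiv ℝ (fun y => levelFun k (f₁ y)) (t • (u : EuclideanSpace ℝ (Fin 2))) (u : EuclideanSpace ℝ (Fin 2)))⁻¹ • fderiv ℝ f₁ (t • (u : EuclideanSpace ℝ (Fin 2))) (u : EuclideanSpace ℝ (Fin 2))) → ContDiff ℝ ((⊤ : ℕ∞) : WithTop ℕ∞) Φ → (∀ x s, HasDerivAt (fun s : ℝ => Φ (s, x)) (V (Φ (s, x))) s) → (∀ x, Φ (0, x) = x) → ∃ (g : EuclideanSpace ℝ (Fin 2) → EuclideanSpace ℝ (Fin 4)) (Rm : EuclideanSpace ℝ (Fin 2) → EuclideanSpace ℝ (Fin 2)) (τ₁ : ℝ), 0 < τ₁ ∧ τ₁ ≤ 1 / 4 ∧ IsModelSliceDisc k K₁ g ∧ g '' Metric.closedBall 0 1 = f₁ '' Metric.closedBall 0 1 ∧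 (∀ x : EuclideanSpace ℝ (Fin 2), ‖x‖ < 1 + τ₁ → g x = f₁ (Rm x)) ∧ (∀ x : EuclideanSpace ℝ (Fin 2), ‖x‖ < 1 + τ₁ → ContDiffAt ℝ ((⊤ : ℕ∞) : WithTop ℕ∞) Rm x) ∧ (∀ x : EuclideanSpace ℝ (Fin 2), ‖x‖ < 1 + τ₁ → Function.Injective (fderiv ℝ Rm x)) ∧ (∀ x : EuclideanSpace ℝ (Fin 2), ‖x‖ ≤ 1 → ‖Rm x‖ ≤ 1) ∧ (∀ x : EuclideanSpace ℝ (Fin 2), ‖x‖ = 1 → Rm x = x) ∧ (∀ x : EuclideanSpace ℝ (Fin 2), 1 - τ₁ ≤ ‖x‖ → g x = Φ (1 - ‖x‖, f₁ (unitVec x))) ∧ (∀ (u : (Metric.sphere (0 : EuclideanSpace ℝ (Fin 2)) 1)) (t : ℝ), 1 - τ₁ ≤ t → t ≤ 1 → g (t • (u : EuclideanSpace ℝ (Fin 2))) = Φ (1 - t, K₁ u)) :=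
  fun k _ _ _ _ _ _ hK hf hneat hV hVR hδ' htan hΦs hΦ hΦ0 => exists_flowDisc k hK hf hneat hV hVR hδ' htan hΦs hΦ hΦ0

end Summit.SmoothPoincare4.SmoothPoincare4.Theorems.DcrGap.MkFriends

end
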